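import Summits.BirchSwinnertonDyer.BirchSwinnertonDyer.Theorems.GenusKolyvaginAtTwoGenusPrimitiveSupplyAtTwoOfKernels
import Summits.BirchSwinnertonDyer.BirchSwinnertonDyer.Theorems.GenusKolyvaginAtTwoGenusPrimitiveSupplyAtTwoTwinSupplyEll
import HarnessLib

/-!
# Route `GenusKolyvaginAtTwo`, glue item stmt-BirchSwinnertonDyer-24951 `GenusPrimitiveSupplyAtTwoOfKernels` (rev 7 split of crux
# 22136) — CLOSED MODULO `GrossZagierAllLevels`, and the corrected glue closed outright

Lead prover seat bsd-line-gk2-p1 (g3). The pen's rev-7 split of crux #2 (V6 of the line's REPAIR CENSUS) types the glue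
`GenusPrimitiveSupplyAtTwoOfKernels : MultiGenusPrimitivityAtTwo → RankOneTwoConverse → RankOneTwoConverseOffSemistableAtTwo →
ModularityExistsNewform → TwoParityDD → CasselsTatePairingRat → MazurRubinProp52Rat → GenusPrimitiveSupplyAtTwo`; its informal text
(and the composition it abbreviates, `GenusKoly.genusPrimitiveSupplyAtTwo_of_namedFacts_of_twoConverse_of_multiGenus`, p593673) ALSO
consumes Gross–Zagier at every level (`GrossZagierAllLevels`, item 24148: `y_K` of infinite order = stub B), which the typed signature
OMITS. `gross_zagier` is a named, unproved Literature fact, so the glue AS TYPED is closable only modulo it: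
* `genusPrimitiveSupplyAtTwoOfKernels_of_grossZagierAllLevels : GrossZagierAllLevels → GenusPrimitiveSupplyAtTwoOfKernels` (CONDITIONAL
  closer of 24951 — conditional-result on the cite-level support 24148, exactly like `closes` itself);
* `genusPrimitiveSupplyAtTwo_of_split` — the corrected glue with `GrossZagierAllLevels` as an antecedent (informal order of 24951),
  proved outright: if the pen re-types 24951 with this antecedent, the closer is `exact genusPrimitiveSupply_of_split`.
The two `2`-converse children compose to the closer's (CONV₂) by cases on `GoodOrd W 2 ∨ Mult W 2`. No summit and no leaf is proved;
the open content of 22136 is `MultiGenusPrimitivityAtTwo` (24947; REPAIR CENSUS v1.2 §6: as typed in ∀K-form it should carry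
`DEF(W,K) = 1`) and the two `2`-converse cruxes. BSD is not proved by any of this.
-/

set_option linter.dupNamespace false -- tree convention: `Summit.BirchSwinnertonDyer.BirchSwinnertonDyer.Theorems` (D-0017)

namespace Summit.BirchSwinnertonDyer.BirchSwinnertonDyer.Theorems.GenusKoly

open Summit.BirchSwinnertonDyer.BirchSwinnertonDyer.Theses.GenusKolyvaginAtTwo Literature.NumberTheory.EllipticCurves

/-- **The two rank-one `2`-converse children give (CONV₂) on all non-CM globally minimal curves** (cases on the reduction type at `2`).
[folklore] -/
theorem twoConverse_of_split (h1 : RankOneTwoConverse) (h2 : RankOneTwoConverseOffSemistableAtTwo) :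
    ∀ (V : WeierstrassCurve ℚ) [V.IsElliptic] [V.IsGloballyMinimal], ¬ V.HasCM → V.selmerCorank 2 = 1 → V.analyticRank = 1 := by
  intro V _ _ hcm hco
  by_cases h : Rank1Residual.GoodOrd V 2 ∨ Rank1Residual.Mult V 2
  · exact h1 V hcm h hco
  · exact h2 V hcm h hco

/-- **Glue item 24951 `GenusPrimitiveSupplyAtTwoOfKernels`, CLOSED MODULO `GrossZagierAllLevels`** (item 24148, cite-level named fact
`gross_zagier` at every level — the one print input the typed glue omits): by
`genusPrimitiveSupplyAtTwo_of_namedFacts_of_twoConverse_of_multiGenus` (p593673). CONDITIONAL on that named fact only.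
[cite: GrossZagier1986, Thm. I.6.3] [cite: MazurRubin2010, Prop. 5.2] [cite: DokchitserDokchitserAnnals2010, Thm. 1.4]
[cite: GrossLMS1991, §3 (3.5), §4 (4.1)] -/
theorem genusPrimitiveSupplyAtTwoOfKernels_of_grossZagierAllLevels (hGZ : GrossZagierAllLevels) :
    GenusPrimitiveSupplyAtTwoOfKernels := by
  unfold GenusPrimitiveSupplyAtTwoOfKernels
  intro hU h1 h2 hmod hpar hCT hMR
  -- R-128 REPAIR (seat bsd-line-gk2-p2 g21, 2026-08-29): since route rev 34 `TwoParityDD` is the PRINT form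
  -- `∀ (V) [V.IsElliptic], p_parity V 2`, which the bare-binder `…_of_namedFacts_of_twoConverse_of_multiGenus` (p593673) cannot
  -- take; its primed twin lives in `…OfKernelsEll`, whose olean the farm could not serve when this repair landed, so the
  -- composition is INLINED here (= the body of `genusPrimitiveSupplyAtTwo_of_twoConverse_of_multiGenus` with the SUPPLY step
  -- taken from the print-typed twin `stub_minimalTwinSupplyAtTwo_of_lowering_of_twoConverse'` of `…TwinSupplyEll`, `hMR := prop52_rat`).
  have hconv := twoConverse_of_split h1 h2
  intro W _ _ _ hcm hr0 hρ hT hopt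
  obtain ⟨K, iF, iN, hIQ, hodd, h3, hHe, hsq1, hsq2, Wd, iE, iM, hWd, hrd, hSel⟩ :=
    stub_minimalTwinSupplyAtTwo_of_lowering_of_twoConverse' hmod hpar hCT hMR hconv W hcm hr0 hρ
  obtain ⟨Dt, hoptDt, hc⟩ := hopt
  obtain ⟨β, hβ⟩ : ∃ β : ℤ, (4 * (W.conductorNorm ℤ : ℕ) : ℤ) ∣ β ^ 2 - NumberField.discr K :=
    Literature.NumberTheory.QuadraticFields.Quadratic.exists_dvd_sq_sub_discr_of_ncard_primesOver hIQ.1 (NeZero.ne _) hHe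
  obtain ⟨ι⟩ : Nonempty (K →+* ℂ) := inferInstance
  obtain ⟨d₁⟩ := exists_kolyvaginHeegnerData_one
    (Literature.NumberTheory.EllipticCurves.phi_heegnerTau_mem_singularModuliField_holds (W.conductorNorm ℤ) W K) hIQ Dt β ι hβ
  have hd : (NumberField.discr K : ℚ) ≠ 0 := by exact_mod_cast NumberField.discr_ne_zero K
  haveI := W.isElliptic_quadraticTwist hd
  have hcmd : ¬ Wd.HasCM := twin_not_hasCM W hcm hd Wd hWd
  have hrtw : (W.quadraticTwist (NumberField.discr K : ℚ)).analyticRank = 1 := by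
    obtain ⟨C, hC⟩ := hWd
    rw [← WeierstrassCurve.analyticRank_smul (W.quadraticTwist (NumberField.discr K : ℚ)) C, hC]
    exact hrd
  have hy : ¬ IsOfFinAddOrder d₁.derivedPoint :=
    stub_heegnerNonTorsionAtTwo_of_grossZagier (fun W _ K _ _ ↦ hGZ _ W K) W K hIQ hHe hr0 hrtw Dt β ι d₁
  obtain ⟨M₀, hdiv, hndiv⟩ := exists_exactTwoDivisibility_of_not_isOfFinAddOrder W hIQ Dt β ι d₁ hy
  obtain ⟨n, d, hn, hKoly, hPn⟩ := exists_derivedPoint_not_two_dvd_of_multiGenusTrace hIQ hodd h3 hHe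
    (hU W hcm hr0 hρ hT K hIQ hodd h3 hHe hsq1 hsq2 Dt hoptDt hc β ι d₁ hy Wd hWd hrd hSel)
  exact ⟨K, iF, iN, hIQ, hodd, h3, hHe, hsq1, hsq2, Dt, β, ι, d₁, hoptDt, hc, hy, M₀, hdiv, hndiv, n, d, hn, hKoly, hPn,
    Wd, iE, iM, hWd, hcmd, hrd, hSel⟩

/-- **The CORRECTED glue, proved outright**: `ModularityExistsNewform → TwoParityDD → CasselsTatePairingRat → MazurRubinProp52Rat →
GrossZagierAllLevels → RankOneTwoConverse → RankOneTwoConverseOffSemistableAtTwo → MultiGenusPrimitivityAtTwo → GenusPrimitiveSupplyAtTwo`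
(the informal text of item 24951, in its order). If the pen re-types the glue with this signature, its closer is `exact` this theorem.
[cite: GrossZagier1986, Thm. I.6.3] [cite: MazurRubin2010, Prop. 5.2] [cite: GrossLMS1991, §3 (3.5), §4 (4.1)] -/
theorem genusPrimitiveSupplyAtTwo_of_split :
    ModularityExistsNewform → TwoParityDD → CasselsTatePairingRat → MazurRubinProp52Rat → GrossZagierAllLevels →
      RankOneTwoConverse → RankOneTwoConverseOffSemistableAtTwo → MultiGenusPrimitivityAtTwo → GenusPrimitiveSupplyAtTwo :=
  fun hmod hpar hCT hMR hGZ h1 h2 hU ↦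
    genusPrimitiveSupplyAtTwoOfKernels_of_grossZagierAllLevels hGZ hU h1 h2 hmod hpar hCT hMR

/-- **The corrected glue in the rev-7 ORDER with `GrossZagierAllLevels` appended** (the other natural re-typing):
`MultiGenusPrimitivityAtTwo → RankOneTwoConverse → RankOneTwoConverseOffSemistableAtTwo → ModularityExistsNewform → TwoParityDD →
CasselsTatePairingRat → MazurRubinProp52Rat → GrossZagierAllLevels → GenusPrimitiveSupplyAtTwo`, proved outright. [cite: GrossZagier1986, Thm. I.6.3] -/
theorem genusPrimitiveSupplyAtTwo_of_split' :
    MultiGenusPrimitivityAtTwo → RankOneTwoConverse → RankOneTwoConverseOffSemistableAtTwo → ModularityExistsNewform → TwoParityDD →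
      CasselsTatePairingRat → MazurRubinProp52Rat → GrossZagierAllLevels → GenusPrimitiveSupplyAtTwo :=
  fun hU h1 h2 hmod hpar hCT hMR hGZ ↦ genusPrimitiveSupplyAtTwoOfKernels_of_grossZagierAllLevels hGZ hU h1 h2 hmod hpar hCT hMR

end Summit.BirchSwinnertonDyer.BirchSwinnertonDyer.Theorems.GenusKoly
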